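import Summits.Ventures.CertifiedManyBodySolver.Observables.EtaPairingExclusionBelowQuarterFilling
import Summits.Ventures.CertifiedManyBodySolver.Certificates.HubbardSquare_afhfCap_n1_U5
import Summits.Ventures.CertifiedManyBodySolver.Certificates.HubbardSquare_afhfCap_n1_U20
import Literature.MathematicalPhysics.QuantumLattice.HubbardFermiSeaTangentRowsLow
import Literature.MathematicalPhysics.QuantumLattice.HubbardTTPrimeFreeSeaGridCeiling
import HarnessLib

/-!
# η-PAIRING ODLRO IS EXCLUDED AT STRONG COUPLING: the closed-form region `U·(1 − n) > 32/π²` and EVERY `U ≥ 0` on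
# `1/2 < n ≤ 3/5` — one-body floors, the filled polarised band and the KERNEL-CHECKED antiferromagnetic Hartree–Fock
# planes as half-filling caps; premise-free, zero solves

HONEST FRAMING: exclusions in Yang's staggered `s`-wave (η) pair channel (`Q = (π,π)` on-site pairs) — where nobody expects
order; NOTHING about `d`-wave pairing or the uniform on-site channel; CTL/dictionary class; REGION-valid at zero solves; a
ceiling never speaks to presence; not a superconductivity verdict; no phase sentence. Crew hubbard-obs (D-0042), seat
hubbard-obs-p1 (`prover-hubbard-obs-p1-g16-0`), PAIRCORR-SDP §24; continuation of `EtaPairingExclusionA0prime` (g13: the lever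
and the generic cell form), `EtaPairingExclusionGridCells[OddU]` (g14: cells), `EtaPairingExclusionBelowQuarterFilling` /
`…WeakCouplingWindows` / `…TangentWindows` / `…AboveThreeHalvesFilling` / `…ElectronDopedTwins` (g15: `|n − 1| ≥ 1/2` at every
`U`, weak-coupling windows, the particle–hole mirror). Companion file `EtaPairingExclusionStrongCouplingColumns` (same seat):
the registry columns `(U, 3/4 | 4/5 | 7/8, 0)` at every `U ≥ 4 | 5 | 8` and all electron-doped mirrors. ZERO compute; no
definition; no `sorry`; NO claim node enters this file.

THE POINT. g15's map left the STRONG-COUPLING side of `1/2 < n < 3/2` open: its only half-filling ceiling was the paramagnetic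
Hartree–Fock line `−16/π² + U/4`, useless above `U ≈ 6.5`. Two better ceilings are already in the tree and cost nothing:
(i) the FILLED POLARISED BAND `e(t, t', U, 1) ≤ 0` (§1: one spin species fills the whole `t–t'` band, whose trace vanishes;
`TTPrimeFree.energyDensityTT'_le_polarizedSea_plane` at grid size `M = 1`), and (ii) the KERNEL-CHECKED antiferromagnetic
Hartree–Fock tangent PLANES `e(1, t', U, 1) ≤ K_{U₀} + D_{U₀}·U` (hubbard-box-p2, `Certificates/HubbardSquare_afhfCap_n1_U*.lean`,
`QFK.energyDensityTT'_le_plane_of_checks` — unconditional theorems, no claim node). With the lever's secant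
`μ₊(n) ≤ (e(U,1) − e(U,n))/(1 − n)` (`chemPotPlusTT'_le_of_bounds_halfFilling2D`) and a floor `ℓ ≤ e(U,n)`:

    `U − 2μ₊(n;U) ≥ U − 2(h − ℓ)/(1 − n)`   for every cap `e(U,1) ≤ h` and floor `ℓ ≤ e(U,n)`   (§2),

and the one-body floors are UNIFORM in `U` (Lieb–Loss bathtub `−16/π²`; the kernel Fermi-sea tangent rows). Consequences (every
`t' = 0` translation-invariant ground state `ω` of density `n`; `M⁻⁴ Re ω(η†_{Λ_M} η_{Λ_M}) → 0` and
`Re ω(η†_Λ η_Λ) ≤ 64(|Λ'| − |Λ|)²/margin²`, `Λ' ⊇ thicken Λ 1`):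
* §2 `etaPairing_exclusion_of_margin` (any `0 < m ≤ U − 2μ₊`) and the GENERIC TWO-INPUT FORM `etaPairing_exclusion_of_floor_of_cap`
  — every future (cap, floor) pair is one `linarith`.
* §3 CLOSED FORM (table-free, premise-free): **`U·(1 − n) > 32/π²` (`0 < n < 1`) excludes η-pairing ODLRO** (cap `0`, bathtub
  floor; decimal form `3.2423 ≤ U(1 − n)`: `n = 7/8` every `U ≥ 25.94`, `3/4` every `U ≥ 12.97`), and the AF-HF-plane refinement
  **`U·(0.9807209526 − n) > 2.4615882554`** (plane at `U₀ = 20`: `n = 7/8` every `U ≥ 23.29`, `3/4` every `U ≥ 10.67`).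
* §4 ALL `U ≥ 0` ON `1/2 < n ≤ 3/5` (premise-free): the weak window of the `n₀ = 1/2` / `7/10` tangent rows (HF cap) reaches
  `U = 3` (resp. `2.95`) and the strong region of the same rows with the `U₀ = 5` plane starts below it (bilinear margins, decided
  at the corners) — so, with g15's `n ≤ 1/2`, **η-pairing ODLRO is absent at EVERY `U ≥ 0` for EVERY density `n ≤ 3/5`**
  (`U > 0` for `n < 1/2`); by the companion file's mirror also for every `n ≥ 7/5`.
SUMMARY SENTENCE (t′ = 0 square lattice, TI ground states; with the companion file): η-pairing ODLRO is ABSENT whenever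
`|n − 1| ≥ 2/5` (every `U ≥ 0`; `U > 0` if `|n − 1| > 1/2`), whenever `U·|1 − n| > 32/π²`, on the three registry columns and their
mirrors from `U = 4, 5, 8` on, and (g15) inside the weak-coupling windows — the complement is a BOUNDED set of `(U, n)` with
`3/5 < n < 7/5`.

WHAT IT IS NOT. The bounded complement (e.g. `(U, 7/8)` with `0.058 < U < 8` off the certified cells, `(U, 3/4)` with
`0.48 < U < 4`) is untouched: there the one-body floor at `n` does not clear the particle–hole tangent from half filling, and only
certified floors at those `(U, n)` would; a Mott gap (`μ₋(1) < U/2`, unproved in `d = 2`) would close everything at once. `t' = 0`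
throughout (η is an exact eigen-operator of `ad(H − μN)` only for bipartite hopping); the half-filling cap of §1 and the planes hold
at every `t'`, but the lever does not.

CITATION FORM (p1 g13/g15 presearch, corpus + galaxy; g16 presearch 2026-08-27 corpus hybrid + vsearch «absence of eta pairing
long-range order … strong coupling / large U … any doping» + galaxy «eta pairing|η-pairing»: no printed infinite-volume statement).
NEAREST PRIOR ART, and the right way to read this file: Yang–Zhang 1990, Thms. 10–11 and Fig. 3 (reprinted in Montorsi (ed.),
*The Hubbard Model*, pp. 52–54) — in finite volume η-ODLRO occurs only on the convex FLAT region `R` of the density plane where the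
energy per site minus `(U/2)n` equals its half-filling value, and the lowest states on `∂R` have `j = |j_z|` (no η-ODLRO); every
theorem below CERTIFIES `(U, n) ∉ R` in the thermodynamic limit — the energy density lies strictly below the particle–hole tangent
from half filling by an explicit margin — and turns that margin into the ODLRO bound through Bratteli–Robinson stability.
[folklore: Yang 1989 commutator + Bratteli–Robinson ground-state stability] — the `[cite:]` tags name the INGREDIENTS. References: C. N. Yang, PRL 63 (1989) 2144,
eqs. (6)–(8) [Yang1989]; C. N. Yang, S. C. Zhang, Mod. Phys. Lett. B 4 (1990) 759, Thm. 11 [YangZhang1990]; O. Bratteli,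
D. W. Robinson, OAQSM 2 (1997) Prop. 5.3.19 [BratteliRobinsonII1997]; V. Bach, E. H. Lieb, J. P. Solovej, J. Stat. Phys. 76
(1994) 3, eq. (2c.36) [BachLiebSolovej1994]; E. H. Lieb, M. Loss, Duke Math. J. 71 (1993) 337, §8 Thm 8.2 [LiebLoss1993];
E. H. Lieb, F. Y. Wu, Physica A 321 (2003) 1, §7 [LiebWuPhysicaA2003]; D. Ruelle, *Statistical Mechanics* (1969) §3.3 [Ruelle1969].
-/

noncomputable section

namespace Summit.Ventures.CertifiedManyBodySolver.Observables

open Matrix Finset Filter Literature.MathematicalPhysics.QuantumLattice Literature.Probability.LatticeModels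
open Literature.MathematicalPhysics.QuantumLattice.HubbardWave0 ThermodynamicLimit
open Summit.Ventures.CertifiedManyBodySolver.Certificates
open scoped ComplexOrder Topology

/-! ### §1 The filled polarised band: `e(t, t', U, 1) ≤ 0` at every `U ≥ 0`, every `t'` -/

/-- **The filled polarised band is a half-filling CEILING at every repulsion**: `e(t, t', U, 1) ≤ 0` (`U ≥ 0`, all real `t, t'`)
— one spin species fills the whole `t–t'` band (no double occupancy), and the band has zero trace; the `M = 1` instance of the
tree's polarised-sea grid ceiling `TTPrimeFree.energyDensityTT'_le_polarizedSea_plane` (`σ₁(0) = (sin 2π − sin 0)/(2π) = 0`).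
[cite: BachLiebSolovej1994, eq. (2c.36)] -/
theorem energyDensityTT'_one_le_zero (t t' : ℝ) {U : ℝ} (hU : 0 ≤ U) : energyDensityTT' t t' U 1 ≤ 0 := by
  have hσ : TTPrimeFree.gridSigma 1 0 = 0 := by
    unfold TTPrimeFree.gridSigma
    have h1 : Real.sin (2 * Real.pi * (((0 : ℕ) : ℝ) + 1) / ((1 : ℕ) : ℝ)) = 0 := by
      rw [show 2 * Real.pi * (((0 : ℕ) : ℝ) + 1) / ((1 : ℕ) : ℝ) = 2 * Real.pi by push_cast; ring]
      exact Real.sin_two_pi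
    have h2 : Real.sin (2 * Real.pi * ((0 : ℕ) : ℝ) / ((1 : ℕ) : ℝ)) = 0 := by
      rw [show 2 * Real.pi * ((0 : ℕ) : ℝ) / ((1 : ℕ) : ℝ) = 0 by push_cast; ring]
      exact Real.sin_zero
    rw [h1, h2, sub_zero, mul_zero]
  have h := TTPrimeFree.energyDensityTT'_le_polarizedSea_plane t t' hU (M := 1) Nat.one_pos
    (Finset.univ : Finset (Fin 1 × Fin 1)) (by simp)
  have hcard : ((Finset.univ : Finset (Fin 1 × Fin 1)).card : ℝ) / ((1 : ℕ) : ℝ) ^ 2 = 1 := by simp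
  rw [hcard] at h
  refine h.trans (le_of_eq ?_)
  simp [hσ]

/-- `t' = 0` reading on the pure-Hubbard object: `energyDensity2D t U 1 ≤ 0` (`U ≥ 0`). [cite: BachLiebSolovej1994, eq. (2c.36)] -/
theorem energyDensity2D_one_le_zero (t : ℝ) {U : ℝ} (hU : 0 ≤ U) : energyDensity2D t U 1 ≤ 0 := by
  rw [← energyDensityTT'_zero]
  exact energyDensityTT'_one_le_zero t 0 hU

/-! ### §2 The lever with an explicit margin; the generic TWO-INPUT secant (any floor at `(U, n)`, any half-filling cap) -/

/-- **THE LEVER WITH AN EXPLICIT MARGIN.** At `(U, n, t' = 0)`, `U ≥ 0`, `0 < n < 2`: any `0 < m ≤ U − 2μ₊(n; U)` excludes η-pairing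
ODLRO in every translation-invariant ground state `ω` of density `n` — `M⁻⁴ Re ω(η†_{Λ_M} η_{Λ_M}) → 0` and
`Re ω(η†_Λ η_Λ) ≤ 64(|Λ'| − |Λ|)²/m²` for every finite `Λ`, `Λ' ⊇ thicken Λ 1` (g13's generic cell form at `μ₊ ≤ (U − m)/2`).
[cite: Yang1989, eqs. (6)–(8)] [cite: BratteliRobinsonII1997, Prop. 5.3.19] -/
theorem etaPairing_exclusion_of_margin {U n m : ℝ} (hU : 0 ≤ U) (hn0 : 0 < n) (hn2 : n < 2) (hm : 0 < m)
    (hle : m ≤ U - 2 * chemPotPlusTT' 1 0 U n)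
    {ω : InfVolFermionState 2} (hω : ω.IsTranslationInvariant) (hρ : ω.density = n)
    (hme : ω.meanEnergy (hubbardTTPrimeFermionInteraction 1 0 U) 1 = energyDensityTT' 1 0 U n) :
    Tendsto (fun M : ℕ =>
        (ω.expect (halfOpenBox 2 M) (etaRaise (fun w : PolySite (halfOpenBox 2 M) => siteStagger (ofLex w.1)) *
          etaLower (fun w : PolySite (halfOpenBox 2 M) => siteStagger (ofLex w.1)))).re / (M : ℝ) ^ 4)
        atTop (𝓝 0) ∧
      ∀ {Λ Λ' : Finset (Site 2)}, Λ ⊆ Λ' → thicken Λ 1 ⊆ Λ' →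
        (ω.expect Λ (etaRaise (fun w : PolySite Λ => siteStagger (ofLex w.1)) *
            etaLower (fun w : PolySite Λ => siteStagger (ofLex w.1)))).re ≤
          64 * ((#Λ' : ℝ) - #Λ) ^ 2 / m ^ 2 := by
  have hμ : chemPotPlusTT' 1 0 U n ≤ (U - m) / 2 := by linarith
  have h2m : 2 * ((U - m) / 2) < U := by linarith
  refine ⟨tendsto_etaPairing_boxLRO_of_chemPotPlus_lt hU hn0 hn2 (by linarith) hω hρ hme, fun hΛ h8 => ?_⟩
  have h := re_expect_etaRaise_mul_etaLower_le_of_chemPotPlus_le hU hn0 hn2 hμ h2m hω hρ hme hΛ h8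
  have e : U - 2 * ((U - m) / 2) = m := by ring
  rwa [e] at h

/-- **Structure-factor form of the lever with a margin**: `M⁻² Re ω(η†_{Λ_M} η_{Λ_M}) ≤ 4096/m²` (`M ≥ 1`).
[cite: Yang1989, eq. (6)] [cite: BratteliRobinsonII1997, Prop. 5.3.19] -/
theorem etaPairing_boxStructureFactor_le_of_margin {U n m : ℝ} (hU : 0 ≤ U) (hn0 : 0 < n) (hn2 : n < 2) (hm : 0 < m)
    (hle : m ≤ U - 2 * chemPotPlusTT' 1 0 U n)
    {ω : InfVolFermionState 2} (hω : ω.IsTranslationInvariant) (hρ : ω.density = n)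
    (hme : ω.meanEnergy (hubbardTTPrimeFermionInteraction 1 0 U) 1 = energyDensityTT' 1 0 U n)
    {M : ℕ} (hM : 1 ≤ M) :
    (ω.expect (halfOpenBox 2 M) (etaRaise (fun w : PolySite (halfOpenBox 2 M) => siteStagger (ofLex w.1)) *
        etaLower (fun w : PolySite (halfOpenBox 2 M) => siteStagger (ofLex w.1)))).re / (M : ℝ) ^ 2 ≤
      4096 / m ^ 2 := by
  have hμ : chemPotPlusTT' 1 0 U n ≤ (U - m) / 2 := by linarith
  have h2m : 2 * ((U - m) / 2) < U := by linarith
  have h := etaPairing_boxStructureFactor_le_of_chemPotPlus_le hU hn0 hn2 hμ h2m hω hρ hme hM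
  have e : U - 2 * ((U - m) / 2) = m := by ring
  rwa [e] at h

/-- **THE TWO-INPUT SECANT.** For `U ≥ 0`, `0 < n < 1`, any floor `ℓ ≤ e(1,0,U,n)` and any half-filling cap `e(1,0,U,1) ≤ h`:
`U − 2μ₊(n; U) ≥ U − 2(h − ℓ)/(1 − n)` (convexity secant of `e(·)` over `[n, 1]`). [cite: LiebWuPhysicaA2003, §7] -/
theorem sub_two_mul_chemPotPlusTT'_ge_of_floor_of_cap {U n ℓ h : ℝ} (hU : 0 ≤ U) (hn0 : 0 < n) (hn1 : n < 1)
    (hℓ : ℓ ≤ energyDensityTT' 1 0 U n) (hh : energyDensityTT' 1 0 U 1 ≤ h) :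
    U - 2 * ((h - ℓ) / (1 - n)) ≤ U - 2 * chemPotPlusTT' 1 0 U n := by
  have hhi : energyDensity2D 1 U 1 ≤ h := by rwa [energyDensityTT'_zero] at hh
  have hμ := chemPotPlusTT'_le_of_bounds_halfFilling2D 1 0 hU hn0 hn1 hℓ hhi
  linarith

/-- **GENERIC TWO-INPUT FORM of the exclusion**: at `(U, n, 0)`, `U ≥ 0`, `0 < n < 1`, a floor `ℓ ≤ e(1,0,U,n)` and a half-filling
cap `e(1,0,U,1) ≤ h` with POSITIVE margin `m := U − 2(h − ℓ)/(1 − n)` exclude η-pairing ODLRO in every translation-invariant ground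
state of density `n` (`M⁻⁴ Re ω(η†η) → 0`, `Re ω(η†_Λ η_Λ) ≤ 64(|Λ'| − |Λ|)²/m²`) — every future (cap, floor) pair is one `linarith`.
[cite: Yang1989, eqs. (6)–(8)] [cite: BratteliRobinsonII1997, Prop. 5.3.19] [cite: LiebWuPhysicaA2003, §7] -/
theorem etaPairing_exclusion_of_floor_of_cap {U n ℓ h : ℝ} (hU : 0 ≤ U) (hn0 : 0 < n) (hn1 : n < 1)
    (hℓ : ℓ ≤ energyDensityTT' 1 0 U n) (hh : energyDensityTT' 1 0 U 1 ≤ h)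
    (hm : 0 < U - 2 * ((h - ℓ) / (1 - n)))
    {ω : InfVolFermionState 2} (hω : ω.IsTranslationInvariant) (hρ : ω.density = n)
    (hme : ω.meanEnergy (hubbardTTPrimeFermionInteraction 1 0 U) 1 = energyDensityTT' 1 0 U n) :
    Tendsto (fun M : ℕ =>
        (ω.expect (halfOpenBox 2 M) (etaRaise (fun w : PolySite (halfOpenBox 2 M) => siteStagger (ofLex w.1)) *
          etaLower (fun w : PolySite (halfOpenBox 2 M) => siteStagger (ofLex w.1)))).re / (M : ℝ) ^ 4)
        atTop (𝓝 0) ∧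
      ∀ {Λ Λ' : Finset (Site 2)}, Λ ⊆ Λ' → thicken Λ 1 ⊆ Λ' →
        (ω.expect Λ (etaRaise (fun w : PolySite Λ => siteStagger (ofLex w.1)) *
            etaLower (fun w : PolySite Λ => siteStagger (ofLex w.1)))).re ≤
          64 * ((#Λ' : ℝ) - #Λ) ^ 2 / (U - 2 * ((h - ℓ) / (1 - n))) ^ 2 :=
  etaPairing_exclusion_of_margin hU hn0 (by linarith) hm
    (sub_two_mul_chemPotPlusTT'_ge_of_floor_of_cap hU hn0 hn1 hℓ hh) hω hρ hme

/-! ### §3 The closed-form strong-coupling region `U·(1 − n) > 32/π²` (cap `0`, bathtub floor) and its AF-HF-plane refinement -/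

/-- Numerical enclosure: `16/π² < 1.62114` (`π > 3.14159265358979`). [folklore] -/
theorem sixteen_div_pi_sq_lt_decimal : 16 / Real.pi ^ 2 < (1.62114 : ℝ) := by
  have hπ : (3.14159265358979 : ℝ) < Real.pi := by
    have := Real.pi_gt_d20
    linarith
  have hpos : (0 : ℝ) < Real.pi ^ 2 := by positivity
  have hsq : (9.8696 : ℝ) < Real.pi ^ 2 := by nlinarith
  rw [div_lt_iff₀ hpos]
  nlinarith

/-- **The bathtub floor in the lever's variable**: `−16/π² ≤ e(1, 0, U, n)` (`U ≥ 0`, `0 ≤ n < 2`).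
[cite: LiebLoss1993, §8, Theorem 8.2] -/
theorem neg_sixteen_div_pi_sq_le_energyDensityTT' {U n : ℝ} (hU : 0 ≤ U) (hn0 : 0 ≤ n) (hn2 : n < 2) :
    -16 / Real.pi ^ 2 ≤ energyDensityTT' 1 0 U n := by
  have h := neg_sixteen_mul_abs_div_pi_sq_le_energyDensityTT' 1 hU hn0 hn2
  simpa using h

/-- **The strong-coupling margin, exact form**: `U − 2μ₊(n; U) ≥ U − 32/(π²(1 − n))` for `U ≥ 0`, `0 < n < 1` — cap `0` (filled
polarised band) and floor `−16/π²` (bathtub) in the two-input secant. [cite: LiebWuPhysicaA2003, §7] [cite: LiebLoss1993, §8, Theorem 8.2] -/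
theorem sub_two_mul_chemPotPlusTT'_ge_strongCoupling {U n : ℝ} (hU : 0 ≤ U) (hn0 : 0 < n) (hn1 : n < 1) :
    U - 32 / (Real.pi ^ 2 * (1 - n)) ≤ U - 2 * chemPotPlusTT' 1 0 U n := by
  have h := sub_two_mul_chemPotPlusTT'_ge_of_floor_of_cap hU hn0 hn1
    (neg_sixteen_div_pi_sq_le_energyDensityTT' hU hn0.le (by linarith)) (energyDensityTT'_one_le_zero 1 0 hU)
  have hπ : (0 : ℝ) < Real.pi ^ 2 := by positivity
  have h1n : (0 : ℝ) < 1 - n := by linarith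
  have e : U - 2 * ((0 - -16 / Real.pi ^ 2) / (1 - n)) = U - 32 / (Real.pi ^ 2 * (1 - n)) := by
    field_simp
    ring
  rwa [e] at h

/-- **η-PAIRING ODLRO IS EXCLUDED ON THE STRONG-COUPLING REGION `U·(1 − n) > 32/π²`** (`t' = 0`, `0 < n < 1`; table-free,
premise-free): for every translation-invariant ground state `ω` of density `n`, `M⁻⁴ Re ω(η†_{Λ_M} η_{Λ_M}) → 0` and
`Re ω(η†_Λ η_Λ) ≤ 64(|Λ'| − |Λ|)²/(U − 32/(π²(1 − n)))²`. The filled polarised band caps `e(U,1)` by `0`, the bathtub floors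
`e(U,n)` by `−16/π²`, so the secant gives `2μ₊(n) ≤ 32/(π²(1 − n)) < U`. [cite: Yang1989, eqs. (6)–(8)]
[cite: BratteliRobinsonII1997, Prop. 5.3.19] [cite: LiebLoss1993, §8, Theorem 8.2] -/
theorem etaPairing_exclusion_of_strongCoupling {U n : ℝ} (hU : 0 ≤ U) (hn0 : 0 < n) (hn1 : n < 1)
    (hs : 32 / Real.pi ^ 2 < U * (1 - n))
    {ω : InfVolFermionState 2} (hω : ω.IsTranslationInvariant) (hρ : ω.density = n)
    (hme : ω.meanEnergy (hubbardTTPrimeFermionInteraction 1 0 U) 1 = energyDensityTT' 1 0 U n) :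
    Tendsto (fun M : ℕ =>
        (ω.expect (halfOpenBox 2 M) (etaRaise (fun w : PolySite (halfOpenBox 2 M) => siteStagger (ofLex w.1)) *
          etaLower (fun w : PolySite (halfOpenBox 2 M) => siteStagger (ofLex w.1)))).re / (M : ℝ) ^ 4)
        atTop (𝓝 0) ∧
      ∀ {Λ Λ' : Finset (Site 2)}, Λ ⊆ Λ' → thicken Λ 1 ⊆ Λ' →
        (ω.expect Λ (etaRaise (fun w : PolySite Λ => siteStagger (ofLex w.1)) *
            etaLower (fun w : PolySite Λ => siteStagger (ofLex w.1)))).re ≤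
          64 * ((#Λ' : ℝ) - #Λ) ^ 2 / (U - 32 / (Real.pi ^ 2 * (1 - n))) ^ 2 := by
  have hπ : (0 : ℝ) < Real.pi ^ 2 := by positivity
  have h1n : (0 : ℝ) < 1 - n := by linarith
  have hm : 0 < U - 32 / (Real.pi ^ 2 * (1 - n)) := by
    rw [sub_pos, div_lt_iff₀ (mul_pos hπ h1n)]
    rw [div_lt_iff₀ hπ] at hs
    nlinarith
  exact etaPairing_exclusion_of_margin hU hn0 (by linarith) hm (sub_two_mul_chemPotPlusTT'_ge_strongCoupling hU hn0 hn1) hω hρ hme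

/-- **Decimal form of the strong-coupling region**: `3.2423 ≤ U(1 − n)` (`0 < n < 1`) suffices (`32/π² < 3.2423`), with margin at
least `U − 3.2423/(1 − n) ≥ 0`... — stated with the sharper exact margin `U − 32/(π²(1−n))`. E.g. `n = 7/8`: every `U ≥ 25.94`;
`n = 3/4`: every `U ≥ 12.97`; `n = 3/5`: every `U ≥ 8.11`. [cite: Yang1989, eqs. (6)–(8)] [cite: LiebLoss1993, §8, Theorem 8.2] -/
theorem etaPairing_exclusion_of_strongCoupling_decimal {U n : ℝ} (hU : 0 ≤ U) (hn0 : 0 < n) (hn1 : n < 1)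
    (hs : (3.2423 : ℝ) ≤ U * (1 - n))
    {ω : InfVolFermionState 2} (hω : ω.IsTranslationInvariant) (hρ : ω.density = n)
    (hme : ω.meanEnergy (hubbardTTPrimeFermionInteraction 1 0 U) 1 = energyDensityTT' 1 0 U n) :
    Tendsto (fun M : ℕ =>
        (ω.expect (halfOpenBox 2 M) (etaRaise (fun w : PolySite (halfOpenBox 2 M) => siteStagger (ofLex w.1)) *
          etaLower (fun w : PolySite (halfOpenBox 2 M) => siteStagger (ofLex w.1)))).re / (M : ℝ) ^ 4)
        atTop (𝓝 0) ∧
      ∀ {Λ Λ' : Finset (Site 2)}, Λ ⊆ Λ' → thicken Λ 1 ⊆ Λ' →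
        (ω.expect Λ (etaRaise (fun w : PolySite Λ => siteStagger (ofLex w.1)) *
            etaLower (fun w : PolySite Λ => siteStagger (ofLex w.1)))).re ≤
          64 * ((#Λ' : ℝ) - #Λ) ^ 2 / (U - 32 / (Real.pi ^ 2 * (1 - n))) ^ 2 := by
  have h32 : 32 / Real.pi ^ 2 < (3.2423 : ℝ) := by
    have h := sixteen_div_pi_sq_lt_decimal
    have hπ : (0 : ℝ) < Real.pi ^ 2 := by positivity
    rw [div_lt_iff₀ hπ] at h ⊢
    linarith
  exact etaPairing_exclusion_of_strongCoupling hU hn0 hn1 (by linarith) hω hρ hme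

/-- **The AF-HF-plane margin (plane at `U₀ = 20`, kernel-checked)**: for `U ≥ 0`, `0 < n < 1`,
`U − 2μ₊(n; U) ≥ U − 2(1.2307941277 + 0.0096395237·U)/(1 − n)` — cap `e(1,·,U,1) ≤ −0.3903458723 + 0.0096395237·U`
(`afhfCap_n1_U20_plane_decimal`), floor `−16/π² > −1.62114`. [cite: BachLiebSolovej1994, eq. (2c.36)] [cite: LiebWuPhysicaA2003, §7] -/
theorem sub_two_mul_chemPotPlusTT'_ge_afhf20 {U n : ℝ} (hU : 0 ≤ U) (hn0 : 0 < n) (hn1 : n < 1) :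
    U - 2 * ((1.2307941277 + 0.0096395237 * U) / (1 - n)) ≤ U - 2 * chemPotPlusTT' 1 0 U n := by
  have hℓ : (-1.62114 : ℝ) ≤ energyDensityTT' 1 0 U n :=
    le_trans (by have := sixteen_div_pi_sq_lt_decimal; rw [neg_div]; linarith)
      (neg_sixteen_div_pi_sq_le_energyDensityTT' hU hn0.le (by linarith))
  have h := sub_two_mul_chemPotPlusTT'_ge_of_floor_of_cap hU hn0 hn1 hℓ (afhfCap_n1_U20_plane_decimal 0 hU)
  have e : -0.3903458723 + U * 0.0096395237 - -1.62114 = (1.2307941277 : ℝ) + 0.0096395237 * U := by ring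
  rwa [e] at h

/-- **η-PAIRING ODLRO IS EXCLUDED ON `U·(0.9807209526 − n) > 2.4615882554`** (`t' = 0`, `0 < n < 1`; premise-free) — the
strong-coupling region with the kernel-checked AF-HF plane at `U₀ = 20` as the half-filling cap (e.g. `n = 7/8`: every `U ≥ 23.29`;
`n = 3/4`: every `U ≥ 10.67`; `n = 3/5`: every `U ≥ 6.47`); margin `U − 2(1.2307941277 + 0.0096395237·U)/(1 − n)`.
[cite: Yang1989, eqs. (6)–(8)] [cite: BratteliRobinsonII1997, Prop. 5.3.19] [cite: BachLiebSolovej1994, eq. (2c.36)] -/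
theorem etaPairing_exclusion_of_strongCoupling_afhf20 {U n : ℝ} (hU : 0 ≤ U) (hn0 : 0 < n) (hn1 : n < 1)
    (hs : (2.4615882554 : ℝ) < U * (0.9807209526 - n))
    {ω : InfVolFermionState 2} (hω : ω.IsTranslationInvariant) (hρ : ω.density = n)
    (hme : ω.meanEnergy (hubbardTTPrimeFermionInteraction 1 0 U) 1 = energyDensityTT' 1 0 U n) :
    Tendsto (fun M : ℕ =>
        (ω.expect (halfOpenBox 2 M) (etaRaise (fun w : PolySite (halfOpenBox 2 M) => siteStagger (ofLex w.1)) *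
          etaLower (fun w : PolySite (halfOpenBox 2 M) => siteStagger (ofLex w.1)))).re / (M : ℝ) ^ 4)
        atTop (𝓝 0) ∧
      ∀ {Λ Λ' : Finset (Site 2)}, Λ ⊆ Λ' → thicken Λ 1 ⊆ Λ' →
        (ω.expect Λ (etaRaise (fun w : PolySite Λ => siteStagger (ofLex w.1)) *
            etaLower (fun w : PolySite Λ => siteStagger (ofLex w.1)))).re ≤
          64 * ((#Λ' : ℝ) - #Λ) ^ 2 / (U - 2 * ((1.2307941277 + 0.0096395237 * U) / (1 - n))) ^ 2 := by
  have h1n : (0 : ℝ) < 1 - n := by linarith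
  have hm : 0 < U - 2 * ((1.2307941277 + 0.0096395237 * U) / (1 - n)) := by
    rw [sub_pos, ← lt_div_iff₀' (by norm_num : (0 : ℝ) < 2), div_lt_iff₀ h1n]
    nlinarith
  exact etaPairing_exclusion_of_margin hU hn0 (by linarith) hm (sub_two_mul_chemPotPlusTT'_ge_afhf20 hU hn0 hn1) hω hρ hme

/-! ### §4 Every `U ≥ 0` on `1/2 < n ≤ 3/5`: the weak window and the strong region OVERLAP (premise-free) -/

/-- **Below half coupling at EVERY `U ≥ 0` for `1/2 < n ≤ 59/100`**: `0 < U − 2μ₊(n; U)`. For `U ≤ 3` the `n₀ = 1/2` Fermi-sea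
tangent row `−0.5879111092 − (5955/4096)n` with the paramagnetic Hartree–Fock cap (g15's one-body secant) has numerator
`U(1 − 2n) + 4(ℓ + 1.6211389) ≥ 7.1329111632 − 11.8154296875·n > 0`; for `U ≥ 3` the same row with the kernel-checked AF-HF plane at
`U₀ = 5` gives `U(0.7976921806 − n) + 1.1941444406 − (5955/2048)n ≥ 3.5872209824 − 5.90771484375·n > 0`.
[cite: LiebLoss1993, §8, Theorem 8.2] [cite: BachLiebSolovej1994, eq. (2c.36)] [cite: LiebWuPhysicaA2003, §7] -/
theorem sub_two_mul_chemPotPlusTT'_pos_of_le_fiftynine_hundredths {U n : ℝ} (hU : 0 ≤ U) (hn : 1 / 2 < n)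
    (hn' : n ≤ 59 / 100) : 0 < U - 2 * chemPotPlusTT' 1 0 U n := by
  have hn0 : 0 < n := by linarith
  have hn1 : n < 1 := by linarith
  have hℓ := fermiSeaTangentRow_tPrime_zero_at_one_div_two hU hn0.le (by linarith : n < 2)
  rcases le_total U 3 with hU3 | hU3
  · -- weak side: HF cap, tangent floor
    have h := sub_two_mul_chemPotPlusTT'_ge_of_floor_decimal hU hn0 hn1 hℓ
    have key : 3 * (1 - 2 * n) ≤ U * (1 - 2 * n) := by nlinarith
    have hnum : 0 < U * (1 - 2 * n) + 4 * (-0.5879111092 + -5955 / 4096 * n + 1.6211389) := by nlinarith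
    have hpos : 0 < (U * (1 - 2 * n) + 4 * (-0.5879111092 + -5955 / 4096 * n + 1.6211389)) / (2 * (1 - n)) :=
      div_pos hnum (by linarith)
    linarith
  · -- strong side: AF-HF plane at `U₀ = 5`, tangent floor
    have h := sub_two_mul_chemPotPlusTT'_ge_of_floor_of_cap hU hn0 hn1 hℓ (afhfCap_n1_U5_plane_decimal 0 hU)
    have h1n : (0 : ℝ) < 1 - n := by linarith
    have key : 3 * (0.7976921806 - n) ≤ U * (0.7976921806 - n) := by nlinarith
    have hlt : (-1.1849833295 + U * 0.1011539097 - (-0.5879111092 + -5955 / 4096 * n)) / (1 - n) < U / 2 := by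
      rw [div_lt_iff₀ h1n]
      nlinarith
    linarith

/-- **Below half coupling at EVERY `U ≥ 0` for `59/100 ≤ n ≤ 3/5`**: `0 < U − 2μ₊(n; U)` — the same two pieces with the
`n₀ = 7/10` tangent row `−1.0141570637 − (3009/4096)n`, split at `U = 2.95` (weak numerator `≥ 5.3779273452 − 8.8384765625·n`,
strong `≥ 2.6948444644 − 4.41923828125·n`). [cite: LiebLoss1993, §8, Theorem 8.2] [cite: BachLiebSolovej1994, eq. (2c.36)]
[cite: LiebWuPhysicaA2003, §7] -/
theorem sub_two_mul_chemPotPlusTT'_pos_of_le_threeFifths {U n : ℝ} (hU : 0 ≤ U) (hn : 59 / 100 ≤ n)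
    (hn' : n ≤ 3 / 5) : 0 < U - 2 * chemPotPlusTT' 1 0 U n := by
  have hn0 : 0 < n := by linarith
  have hn1 : n < 1 := by linarith
  have hℓ := fermiSeaTangentRow_tPrime_zero_at_seven_div_ten hU hn0.le (by linarith : n < 2)
  rcases le_total U 2.95 with hU3 | hU3
  · have h := sub_two_mul_chemPotPlusTT'_ge_of_floor_decimal hU hn0 hn1 hℓ
    have key : 2.95 * (1 - 2 * n) ≤ U * (1 - 2 * n) := by nlinarith
    have hnum : 0 < U * (1 - 2 * n) + 4 * (-1.0141570637 + -3009 / 4096 * n + 1.6211389) := by nlinarith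
    have hpos : 0 < (U * (1 - 2 * n) + 4 * (-1.0141570637 + -3009 / 4096 * n + 1.6211389)) / (2 * (1 - n)) :=
      div_pos hnum (by linarith)
    linarith
  · have h := sub_two_mul_chemPotPlusTT'_ge_of_floor_of_cap hU hn0 hn1 hℓ (afhfCap_n1_U5_plane_decimal 0 hU)
    have h1n : (0 : ℝ) < 1 - n := by linarith
    have key : 2.95 * (0.7976921806 - n) ≤ U * (0.7976921806 - n) := by nlinarith
    have hlt : (-1.1849833295 + U * 0.1011539097 - (-1.0141570637 + -3009 / 4096 * n)) / (1 - n) < U / 2 := by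
      rw [div_lt_iff₀ h1n]
      nlinarith
    linarith

/-- **Strictly below half coupling at EVERY `U ≥ 0` on the whole slab `1/2 < n ≤ 3/5`**: `0 < U − 2μ₊(n; U)` (the two sub-slabs).
[cite: LiebWuPhysicaA2003, §7] [cite: BachLiebSolovej1994, eq. (2c.36)] -/
theorem sub_two_mul_chemPotPlusTT'_pos_of_half_lt_of_le_threeFifths {U n : ℝ} (hU : 0 ≤ U) (hn : 1 / 2 < n)
    (hn' : n ≤ 3 / 5) : 0 < U - 2 * chemPotPlusTT' 1 0 U n := by
  rcases le_total n (59 / 100) with h | h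
  · exact sub_two_mul_chemPotPlusTT'_pos_of_le_fiftynine_hundredths hU hn h
  · exact sub_two_mul_chemPotPlusTT'_pos_of_le_threeFifths hU h hn'

/-- **η-PAIRING ODLRO IS ABSENT AT EVERY `U ≥ 0` FOR EVERY `1/2 < n ≤ 3/5`** (`t' = 0`; premise-free, one-body floors + the
kernel-checked AF-HF plane at `U₀ = 5`): for every translation-invariant ground state `ω` of density `n`,
`M⁻⁴ Re ω(η†_{Λ_M} η_{Λ_M}) → 0` and `Re ω(η†_Λ η_Λ) ≤ 64(|Λ'| − |Λ|)²/(U − 2μ₊(n;U))²` with `U − 2μ₊(n;U) > 0`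
(`sub_two_mul_chemPotPlusTT'_pos_of_half_lt_of_le_threeFifths`). With g15's `etaPairing_exclusion_of_lt_quarterFilling` /
`…_quarterFilling` the exclusion now holds at every `U` for EVERY `n ≤ 3/5`. [cite: Yang1989, eqs. (6)–(8)]
[cite: BratteliRobinsonII1997, Prop. 5.3.19] [cite: LiebLoss1993, §8, Theorem 8.2] -/
theorem etaPairing_exclusion_of_half_lt_of_le_threeFifths {U n : ℝ} (hU : 0 ≤ U) (hn : 1 / 2 < n) (hn' : n ≤ 3 / 5)
    {ω : InfVolFermionState 2} (hω : ω.IsTranslationInvariant) (hρ : ω.density = n)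
    (hme : ω.meanEnergy (hubbardTTPrimeFermionInteraction 1 0 U) 1 = energyDensityTT' 1 0 U n) :
    Tendsto (fun M : ℕ =>
        (ω.expect (halfOpenBox 2 M) (etaRaise (fun w : PolySite (halfOpenBox 2 M) => siteStagger (ofLex w.1)) *
          etaLower (fun w : PolySite (halfOpenBox 2 M) => siteStagger (ofLex w.1)))).re / (M : ℝ) ^ 4)
        atTop (𝓝 0) ∧
      ∀ {Λ Λ' : Finset (Site 2)}, Λ ⊆ Λ' → thicken Λ 1 ⊆ Λ' →
        (ω.expect Λ (etaRaise (fun w : PolySite Λ => siteStagger (ofLex w.1)) *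
            etaLower (fun w : PolySite Λ => siteStagger (ofLex w.1)))).re ≤
          64 * ((#Λ' : ℝ) - #Λ) ^ 2 / (U - 2 * chemPotPlusTT' 1 0 U n) ^ 2 :=
  etaPairing_exclusion_of_margin hU (by linarith) (by linarith)
    (sub_two_mul_chemPotPlusTT'_pos_of_half_lt_of_le_threeFifths hU hn hn') le_rfl hω hρ hme

end Summit.Ventures.CertifiedManyBodySolver.Observables
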